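import Mathlib.Geometry.Manifold.PoincareConjecture
import Mathlib.AlgebraicTopology.FundamentalGroupoid.SimplyConnected
import Mathlib.SetTheory.Cardinal.Finite
import Mathlib.GroupTheory.SpecificGroups.Cyclic
import Literature.Topology.FourManifolds.Cobordism
import Literature.Topology.FourManifolds.ConnectedSum
import Literature.Topology.FourManifolds.HomotopySpheres
import Literature.Topology.FourManifolds.SmoothOrientation
import HarnessLib

-- provenance: harness21/H21/H21/Statements/SPC4/HCobordism.lean @ 53e468a (interim HEAD d8f2665); M5 mechanical rewrite
/-!
# SPC4 — h-cobordisms and the groups `Θₙ` (statement file)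

Family `spc4` of the H21 statement library, file `Statements/SPC4/HCobordism.lean` of the G18
outline (`H21/Outlines/FourManM.md`, §3): the smooth h-cobordism theorem in dimensions `≥ 5`,
its failure in dimension `4`, and Kervaire–Milnor's finiteness of the groups of homotopy spheres.

## Covered statement ids

* `spc4.S15` (Smale 1962; Milnor 1965, Thm 9.1): a simply connected smooth h-cobordism between
  closed smooth `n`-manifolds, `n ≥ 5`, is a product (`isTrivial_of_isHCobordism_of_five_le`), and
  the corollary that h-cobordant simply connected closed smooth `n`-manifolds, `n ≥ 5`, are
  diffeomorphic (`nonempty_diffeomorph_of_isHCobordant_of_five_le`).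
* `spc4.S16` (Donaldson 1987; Freedman 1982): there are h-cobordant simply connected closed
  smooth 4-manifolds that are not diffeomorphic (`exists_isHCobordant_isEmpty_diffeomorph_four`).
* `spc4.S13` (Kervaire–Milnor 1963, Thm 1.2 and §7): `Θₙ` is finite for `n ≠ 4`
  (`finite_homotopySphereClass`; its `n ≥ 5` inventory form is the proved corollary
  `finite_homotopySphereClass.of_five_le`), `|Θ₇| = 28` (`natCard_homotopySphereClass_seven`) and
  `Θ₇ ≅ ℤ/28` is cyclic (`exists_commGroup_homotopySphereClass_isCyclic_seven`).

## Notation and conventions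

Manifolds are `[TopologicalSpace M] [T2Space M] [SecondCountableTopology M]
[ChartedSpace (𝔼 n) M] [IsManifold (𝓡 n) ∞ M] [CompactSpace M]` (closed smooth `n`-manifolds), as
in `Statements/SPC4/Wave0.lean` and Mathlib's `PoincareConjecture.lean`; existential manifolds
live in `Type`, universal ones are universe polymorphic. Cobordisms, h-cobordisms and triviality
are the prelude notions `Literature.Topology.FourManifolds.Cobordism`, `Literature.Topology.FourManifolds.Cobordism.IsHCobordism`, `Literature.Topology.FourManifolds.IsHCobordant`,
`Literature.Topology.FourManifolds.Cobordism.IsTrivial` (`Prelude/FourManM/Cobordism.lean`); since `Cobordism n M N` imposes no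
smoothness on its ends, every statement here adds the full closed-smooth-manifold instances on
`M` and `N`.

`Θₙ` is the type `Literature.HomotopySphereClass n` (`Prelude/FourManM/HomotopySpheres.lean`): oriented
homotopy `n`-spheres modulo orientation-preserving diffeomorphism. For `n ≥ 5` this is
Kervaire–Milnor's quotient by h-cobordism (prelude theorem
`HomotopySphere.isHCobordant_iff_nonempty_diffeomorph_of_five_le`); the group law is the
*relational* connected sum `HomotopySphereClass.IsMul a b c` ("`a # b = c`"), and the group
structure is the prelude theorem `exists_commGroup_homotopySphereClass`.

## Deliberately not stated

* Finiteness of `Θ₄`: our `Θ₄` is the oriented-diffeomorphism quotient of homotopy 4-spheres,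
  whose finiteness (indeed triviality) is of the strength of the smooth 4-dimensional Poincaré
  conjecture; Kervaire–Milnor's `Θ₄ = 0` concerns the h-cobordism quotient.
* The exact orders `|Θₙ|` for `n ≠ 7` and the structure `Θₙ / bP_{n+1} ↪ coker J`
  (Kervaire–Milnor 1963, §§4–8): out of scope.
* Freedman's topological conclusion in dimension 4 is the prelude theorem
  `Literature.Topology.FourManifolds.nonempty_homeomorph_of_isHCobordant_four` and is not restated.

## Mathlib

Mathlib has `Diffeomorph`, `ContinuousMap.HomotopyEquiv`, `SimplyConnectedSpace`, `Finite`,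
`Nat.card`, `IsCyclic` and the smooth Poincaré statements of `PoincareConjecture.lean`
(including `proof_wanted exists_homeomorph_isEmpty_diffeomorph_sphere_seven`, Milnor's exotic
7-sphere), but no cobordisms, h-cobordisms or `Θₙ` (`rg -i 'cobordism|homotopy sphere'` in
`Mathlib/Geometry/Manifold`: only Rothgang's `SingularManifold` towards unoriented bordism).

Sources: S. Smale, *On the structure of manifolds*, Amer. J. Math. 84 (1962), Thm 1.1 and
Cor. 1.3; J. Milnor, *Lectures on the h-cobordism theorem* (1965), Thm 9.1; S. K. Donaldson,
*Irrationality and the h-cobordism conjecture*, J. Diff. Geom. 26 (1987); M. Freedman, J. Diff.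
Geom. 17 (1982), Thm 1.5; M. Kervaire, J. Milnor, *Groups of homotopy spheres I*, Ann. of Math.
77 (1963), Thms 1.1–1.2, §7; G. Perelman (2002–03).
-/

open scoped Manifold ContDiff Topology ContinuousMap

noncomputable section

namespace Literature.Topology.FourManifolds

universe u

/-- Local notation: `𝔼 n` is the model Euclidean space `EuclideanSpace ℝ (Fin n)`. -/
local notation "𝔼 " n:arg => EuclideanSpace ℝ (Fin n)

/-! ### spc4.S15: the smooth h-cobordism theorem (`n ≥ 5`) -/

/-- **spc4.S15** (smooth h-cobordism theorem; Smale, Amer. J. Math. 84 (1962), Thm 1.1; Milnor,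
*Lectures on the h-cobordism theorem* (1965), Thm 9.1). Let `M`, `N` be closed smooth
`n`-manifolds, `n ≥ 5`, and `W` an h-cobordism between them (both inclusions `M ↪ W`, `N ↪ W` are
homotopy equivalences) whose total space is simply connected. Then `W` is a product: there is a
diffeomorphism `W ≅ M × [0, 1]` sending `inl x` to `(x, 0)` (`Literature.Topology.FourManifolds.Cobordism.IsTrivial`). Simple
connectivity is put on `c.W`; it is equivalent to that of `M` (or `N`) since the inclusions are
homotopy equivalences. Known theorem (Smale). [cite: MilnorHCobordism1965, Thm. 9.1 (h-cobordism theorem, Smale 1962)] [cite: Smale1962, Thm. 1.1 and Cor. 1.3] -/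
def isTrivial_of_isHCobordism_of_five_le : Prop :=
  ∀ {n : ℕ} (hn : 5 ≤ n) {M N : Type u} [TopologicalSpace M] [T2Space M] [SecondCountableTopology M] [ChartedSpace (𝔼 n) M] [IsManifold (𝓡 n) ∞ M] [CompactSpace M] [TopologicalSpace N] [T2Space N] [SecondCountableTopology N] [ChartedSpace (𝔼 n) N] [IsManifold (𝓡 n) ∞ N] [CompactSpace N] (c : Cobordism n M N) (hc : c.IsHCobordism) (hW : SimplyConnectedSpace c.W),
    c.IsTrivial

/-- **spc4.S15** (corollary of the smooth h-cobordism theorem; Smale 1962, Cor. 1.3; Milnor,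
*Lectures on the h-cobordism theorem* (1965), Thm 9.1). Simply connected closed smooth
`n`-manifolds, `n ≥ 5`, that are h-cobordant (`Literature.Topology.FourManifolds.IsHCobordant`) are diffeomorphic. Simple
connectivity is assumed on `M` only: `N ≃ₕ W ≃ₕ M` are then simply connected as well. Follows from
`isTrivial_of_isHCobordism_of_five_le` and `Literature.Topology.FourManifolds.Cobordism.nonempty_diffeomorph_of_isTrivial`.
Known theorem. [cite: Smale1962, Cor. 1.3] -/
def nonempty_diffeomorph_of_isHCobordant_of_five_le : Prop :=
  ∀ {n : ℕ} (hn : 5 ≤ n) {M N : Type u} [TopologicalSpace M] [T2Space M] [SecondCountableTopology M] [ChartedSpace (𝔼 n) M] [IsManifold (𝓡 n) ∞ M] [CompactSpace M] [SimplyConnectedSpace M] [TopologicalSpace N] [T2Space N] [SecondCountableTopology N] [ChartedSpace (𝔼 n) N] [IsManifold (𝓡 n) ∞ N] [CompactSpace N] (h : IsHCobordant n M N),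
    Nonempty (M ≃ₘ⟮𝓡 n, 𝓡 n⟯ N)

/-! ### spc4.S16: failure of the smooth h-cobordism theorem in dimension 4 -/

/-- **spc4.S16** (Donaldson, *Irrationality and the h-cobordism conjecture*, J. Diff. Geom. 26
(1987); with Freedman, J. Diff. Geom. 17 (1982), Thm 1.5, and Wall 1964). There exist simply
connected closed smooth 4-manifolds `M`, `N` (Hausdorff, second countable, compact, modelled on
`ℝ⁴`) which are smoothly h-cobordant (`Literature.IsHCobordant 4 M N`) but not diffeomorphic: the smooth
5-dimensional h-cobordism theorem fails. (Example: `ℂℙ² # 9(-ℂℙ²)` and the Dolgachev surface are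
homeomorphic by Freedman, hence h-cobordant by Wall, and not diffeomorphic by Donaldson.) Stated
in the pattern of `Literature.Topology.FourManifolds.ExistsExoticFourSphere`, with `M N : Type`. Known theorem.
Printed: Donaldson 1987, p. 142 ("So `Z` and `P² # 9P̄²` are h-cobordant nondiffeomorphic manifolds and
they give a counterexample to the 'h-cobordism conjecture' for smooth 4-manifolds"), from
Prop. (3.16)(ii), p. 159 (`Z` simply connected, smoothly h-cobordant and homeomorphic to `Y`) and
Thm. (3.24), p. 163 (`Z` not diffeomorphic to `Y`), the h-cobordism being Wall 1964, Thm. 2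
(isomorphic forms ⇒ h-cobordant). Decomposed along this proof, with the assembly step proved, in
the sibling `HCobordismDonaldson.lean` (`exists_isHCobordant_isEmpty_diffeomorph_four_of`). [cite: DonaldsonIrrationality1987, p. 142 with Prop. (3.16)(ii) p. 159 and Thm. (3.24) p. 163] [cite: WallJLMS1964, Thm. 2 (p. 141)] -/
def exists_isHCobordant_isEmpty_diffeomorph_four : Prop :=
  ∃ (M N : Type) (_ : TopologicalSpace M) (_ : T2Space M) (_ : SecondCountableTopology M)
      (_ : ChartedSpace (𝔼 4) M) (_ : IsManifold (𝓡 4) ∞ M) (_ : CompactSpace M)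
      (_ : SimplyConnectedSpace M)
      (_ : TopologicalSpace N) (_ : T2Space N) (_ : SecondCountableTopology N)
      (_ : ChartedSpace (𝔼 4) N) (_ : IsManifold (𝓡 4) ∞ N) (_ : CompactSpace N)
      (_ : SimplyConnectedSpace N),
      IsHCobordant 4 M N ∧ IsEmpty (M ≃ₘ⟮𝓡 4, 𝓡 4⟯ N)

/-! ### spc4.S13: finiteness of `Θₙ` and `Θ₇ ≅ ℤ/28` -/

/-- **spc4.S13** (Kervaire–Milnor, *Groups of homotopy spheres I*, Ann. of Math. 77 (1963),
Thm 1.2, p. 504: "For `n ≠ 3` the group `Θₙ` is finite"; Perelman (2002–03) for `n = 3`). For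
`n ≠ 4` the type `Θₙ = HomotopySphereClass n` of oriented homotopy `n`-spheres modulo
orientation-preserving diffeomorphism is finite. For `n ≥ 5` this quotient is Kervaire–Milnor's
group of h-cobordism classes (`HomotopySphere.isHCobordant_iff_nonempty_diffeomorph_of_five_le`;
Kervaire–Milnor p. 505: "for `n ≠ 3, 4` … the group `Θₙ` can be described as the set of all
diffeomorphism classes of differentiable structures on the topological `n`-sphere") with group law
the relational connected sum `HomotopySphereClass.IsMul`, and its finiteness is Thm 1.2, whose
proof occupies §§4–8 there (Thm 4.1, p. 510: `Θₙ / bPₙ₊₁` is finite — it embeds into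
`Πₙ / p(Sⁿ)`, finite by Serre, p. 512; Thm 5.1 (p. 512), Cor. 7.6 (p. 530) and Thm 8.5 (p. 536):
`bPₙ₊₁` is zero for `n` even and finite cyclic for `n` odd, `n ≠ 3`) — a whole theory (Pontryagin–Thom
construction, finiteness of the stable stems, surgery), none of it in Mathlib or in the tree. For
`1 ≤ n ≤ 3` the quotient is a point: `Θ₁ = Θ₂ = 0` (Kervaire–Milnor p. 504; tree theorems
`HomotopySphereClass.subsingleton_one`, `HomotopySphereClass.subsingleton_two`) and `Θ₃ = 0` by
Perelman (Morgan–Tian 2007, Cor. 0.2 (a); cf. `subsingleton_homotopySphereClass_of_forall`); for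
`n = 0` the carriers are two-point spaces. The case `n = 4` is excluded: finiteness of our `Θ₄` is
of the strength of the smooth 4-dimensional Poincaré conjecture. Known theorem; the `n ≥ 5`
inventory form of spc4.S13 is the proved corollary `finite_homotopySphereClass.of_five_le` below. [cite: KervaireMilnorAnnals1963, Thm. 1.2 (p. 504; proof §§4–8, reduction p. 512)] [cite: MorganTian2007, Cor. 0.2 (a)] -/
def finite_homotopySphereClass : Prop :=
  ∀ (n : ℕ) (hn : n ≠ 4),
    Finite (HomotopySphereClass n)

/-- **spc4.S13**, inventory form for `n ≥ 5` (Kervaire–Milnor, Ann. of Math. 77 (1963), Thm 1.2,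
p. 504, with p. 505 for the identification of the h-cobordism quotient with the
oriented-diffeomorphism quotient `Θₙ = HomotopySphereClass n` in dimensions `n ≥ 5`): `Θₙ` is
finite for `n ≥ 5` — the instance `n ≥ 5` (so `n ≠ 4`) of the named fact
`finite_homotopySphereClass`, of which it was the one-line corollary in the H21 statement library;
kept as a proved corollary (the former separate named fact `finite_homotopySphereClass_of_five_le`
restated nothing beyond `finite_homotopySphereClass` and is merged into it, D-0026). [cite: KervaireMilnorAnnals1963, Thm. 1.2 (p. 504) and p. 505] -/
theorem finite_homotopySphereClass.of_five_le (h : finite_homotopySphereClass) {n : ℕ}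
    (hn : 5 ≤ n) : Finite (HomotopySphereClass n) :=
  h n (by omega)

/-- **spc4.S13** (Kervaire–Milnor, Ann. of Math. 77 (1963), Thm 1.2 and §7, table p. 504; Milnor
1956/1959). `Θ₇ = HomotopySphereClass 7`, the oriented homotopy 7-spheres modulo
orientation-preserving diffeomorphism (= h-cobordism classes, `n = 7 ≥ 5`), has exactly `28`
elements: there are `28` oriented diffeomorphism classes of smooth structures on `S⁷`. Known
theorem. [cite: KervaireMilnorAnnals1963, Thm. 1.2 and §7 (table p. 504)] -/
def natCard_homotopySphereClass_seven : Prop :=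
  Nat.card (HomotopySphereClass 7) = 28

/-- **spc4.S13** (Kervaire–Milnor, Ann. of Math. 77 (1963), Thm 1.2, §7 and Milnor, *Differentiable
structures on spheres*, Amer. J. Math. 81 (1959): `Θ₇ = bP₈ ≅ ℤ/28`). The type
`Θ₇ = HomotopySphereClass 7` (oriented homotopy 7-spheres modulo orientation-preserving
diffeomorphism, = h-cobordism classes) carries a commutative group structure whose multiplication
is the relational connected sum (`HomotopySphereClass.IsMul a b c → a * b = c`; such a structure
exists and its multiplication is determined by `IsMul`, prelude
`exists_commGroup_homotopySphereClass`, `HomotopySphereClass.isMul_exists`) and which is cyclic;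
with `natCard_homotopySphereClass_seven` this says `Θ₇ ≅ ℤ/28`. Known theorem. [cite: KervaireMilnorAnnals1963, Thm. 1.1–1.2 and §7 (Θ₇ ≅ ℤ/28)] -/
def exists_commGroup_homotopySphereClass_isCyclic_seven : Prop :=
  ∃ _ : CommGroup (HomotopySphereClass 7),
      (∀ a b c : HomotopySphereClass 7, HomotopySphereClass.IsMul a b c → a * b = c) ∧
      IsCyclic (HomotopySphereClass 7)

end Literature.Topology.FourManifolds
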